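import Literature.Analysis.FluidPDE.PassiveVectorGalerkinSolution
import HarnessLib

/-!
# The Fourier–Galerkin scheme for the passive solenoidal vector, VI: energy bounds pass to the Galerkin limit

Analysis/FluidPDE proof-support file (theorems only; no definitions, no named facts), sequel of
`PassiveVectorGalerkinSolution`. Lower semicontinuity / continuity of the energy under the modewise limit
(Robinson–Rodrigo–Sadowski 2016, Thm. 4.4 Step 3 and Lemma 4.1; Parseval): for a Galerkin limit `w` of the data
`PVSetup κ b B β C Sec w₀` along the subsequence `φ`, at every time `t ≥ 0`,

* an UPPER bound valid for the coefficient energies `∑_k ‖α_{φ n}(t) k‖²` of the approximations eventually in `n`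
  is inherited by `∫‖w t‖²` (`integral_norm_sq_le_of_eventually_galerkin_le`);
* a LOWER bound valid eventually for the energy `∑_{k∈G} ‖α_{φ n}(t)(k)‖²` carried by a fixed finite set of modes `G`
  is inherited by `∫‖w t‖²` (`le_integral_norm_sq_of_eventually_le_galerkin_modes`).

These turn uniform-in-`N` estimates on the Galerkin truncations (the object of the Bloch-sector analysis of crux K2R
`RealisedQuasiStaticCellLaw`, stubs `stub_lowSectorDecay` / `stub_upperSome`) into estimates on the weak solution.

## References

* J. C. Robinson, J. L. Rodrigo, W. Sadowski, *The three-dimensional Navier–Stokes equations* (CUP 2016),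
  Thm. 4.4 Step 3, Lemma 4.1, Thm. 4.6. [`RobinsonRodrigoSadowski2016`]
-/

open MeasureTheory Set Filter Topology UnitAddTorus Function
open scoped ENNReal NNReal InnerProductSpace

noncomputable section

namespace Literature.Analysis.FluidPDE

namespace Torus

open FunctionSpaces.Torus FunctionSpaces

variable {d : Type*} [Fintype d] [DecidableEq d]

variable {b : ℝ → UnitAddTorus d → EuclideanSpace ℝ d} {B : Finset (d → ℤ)}
  {β : ℝ → (d → ℤ) → EuclideanSpace ℂ d} {C κ : ℝ} {Sec : Set (d → ℤ)}
  {w₀ : UnitAddTorus d → EuclideanSpace ℝ d}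
  {h : PVSetup κ b B β C Sec w₀} {φ : ℕ → ℕ} {c : ℝ → (d → ℤ) → EuclideanSpace ℂ d}
  {w : ℝ → UnitAddTorus d → EuclideanSpace ℝ d}

/-- The coefficient energy on a finite set of modes is at most the coefficient energy of the approximation:
`∑_{k∈F} ‖α_N(t)(k)‖² ≤ ∑_k ‖α_N t k‖²` (the extension vanishes off the ball). [cite: RobinsonRodrigoSadowski2016, Thm. 4.4 Step 2 (4.8)] -/
theorem PVSetup.sum_norm_sq_galerkinCoeffAt_le_sum (h : PVSetup κ b B β C Sec w₀) (N : ℕ) (t : ℝ)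
    (F : Finset (d → ℤ)) :
    ∑ k ∈ F, ‖h.galerkinCoeffAt N t k‖ ^ 2 ≤ ∑ k, ‖h.galerkinCoeff N t k‖ ^ 2 := by
  classical
  have hsplit : ∑ k ∈ F, ‖h.galerkinCoeffAt N t k‖ ^ 2 = ∑ k ∈ F ∩ freqBall N, ‖h.galerkinCoeffAt N t k‖ ^ 2 := by
    refine (Finset.sum_subset Finset.inter_subset_left fun k hkF hk => ?_).symm
    have hkS : k ∉ freqBall N := fun hkS => hk (Finset.mem_inter.2 ⟨hkF, hkS⟩)
    rw [PVSetup.galerkinCoeffAt, coeffExt_of_not_mem _ hkS]; simp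
  rw [hsplit]
  calc ∑ k ∈ F ∩ freqBall N, ‖h.galerkinCoeffAt N t k‖ ^ 2
      ≤ ∑ k ∈ freqBall N, ‖h.galerkinCoeffAt N t k‖ ^ 2 :=
        Finset.sum_le_sum_of_subset_of_nonneg Finset.inter_subset_right fun k _ _ => sq_nonneg _
    _ = ∑ k, ‖h.galerkinCoeff N t k‖ ^ 2 := by
        rw [← Finset.sum_coe_sort]
        exact Finset.sum_congr rfl fun k _ => by rw [PVSetup.galerkinCoeffAt, coeffExt_coe]

/-- **Upper energy bounds pass to the Galerkin limit**: if, eventually along the subsequence, the coefficient energy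
of the approximation at time `t ≥ 0` is at most `M`, then `∫‖w t‖² ≤ M` (finite partial sums converge mode by
mode; Parseval for the limit). [cite: RobinsonRodrigoSadowski2016, Thm. 4.6] -/
theorem PVSetup.IsGalerkinLimit.integral_norm_sq_le_of_eventually_galerkin_le (hl : h.IsGalerkinLimit φ c w)
    {t : ℝ} (ht : 0 ≤ t) {M : ℝ} (hM : ∀ᶠ n in atTop, ∑ k, ‖h.galerkinCoeff (φ n) t k‖ ^ 2 ≤ M) :
    ∫ x, ‖w t x‖ ^ 2 ≤ M := by
  have hP := hasSum_sq_norm_mFourierCoeff_complexify (hl.memLp t ht)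
  simp_rw [hl.coeff_eq t ht] at hP
  rw [← hP.tsum_eq]
  refine hP.summable.tsum_le_of_sum_le fun F => ?_
  have hF : Tendsto (fun n => ∑ k ∈ F, ‖h.galerkinCoeffAt (φ n) t k‖ ^ 2) atTop (𝓝 (∑ k ∈ F, ‖c t k‖ ^ 2)) :=
    tendsto_finsetSum F fun k _ => ((hl.tendsto_coeff t ht k).norm).pow 2
  exact le_of_tendsto hF (hM.mono fun n hn => (h.sum_norm_sq_galerkinCoeffAt_le_sum (φ n) t F).trans hn)

/-- **Lower energy bounds on finitely many modes pass to the Galerkin limit**: if, eventually along the subsequence,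
`m ≤ ∑_{k∈G} ‖α_{φ n}(t)(k)‖²` for a fixed finite set of modes `G` and a time `t ≥ 0`, then `m ≤ ∫‖w t‖²`. [cite: RobinsonRodrigoSadowski2016, Thm. 4.6] -/
theorem PVSetup.IsGalerkinLimit.le_integral_norm_sq_of_eventually_le_galerkin_modes (hl : h.IsGalerkinLimit φ c w)
    {t : ℝ} (ht : 0 ≤ t) (G : Finset (d → ℤ)) {m : ℝ}
    (hm : ∀ᶠ n in atTop, m ≤ ∑ k ∈ G, ‖h.galerkinCoeffAt (φ n) t k‖ ^ 2) :
    m ≤ ∫ x, ‖w t x‖ ^ 2 := by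
  have hP := hasSum_sq_norm_mFourierCoeff_complexify (hl.memLp t ht)
  simp_rw [hl.coeff_eq t ht] at hP
  have hG : Tendsto (fun n => ∑ k ∈ G, ‖h.galerkinCoeffAt (φ n) t k‖ ^ 2) atTop (𝓝 (∑ k ∈ G, ‖c t k‖ ^ 2)) :=
    tendsto_finsetSum G fun k _ => ((hl.tendsto_coeff t ht k).norm).pow 2
  have h1 : m ≤ ∑ k ∈ G, ‖c t k‖ ^ 2 := ge_of_tendsto hG hm
  exact h1.trans (sum_le_hasSum G (fun k _ => sq_nonneg _) hP)

omit [DecidableEq d] in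
/-- **Two weak solutions with the same data have the same energy a.e.** (used with the uniqueness of weak solutions
around bounded carriers): if `w₁ t =ᵐ w₂ t` for a.e. `t ∈ (0,T)`, then `∫‖w₁ t‖² = ∫‖w₂ t‖²` for a.e. `t ∈ (0,T)`. [cite: RobinsonRodrigoSadowski2016, Thm. 4.6] -/
theorem ae_integral_norm_sq_congr {T : ℝ} {w₁ w₂ : ℝ → UnitAddTorus d → EuclideanSpace ℝ d}
    (hae : ∀ᵐ t ∂(volume.restrict (Ioo 0 T)), w₁ t =ᵐ[volume] w₂ t) :
    ∀ᵐ t ∂(volume.restrict (Ioo 0 T)), ∫ x, ‖w₁ t x‖ ^ 2 = ∫ x, ‖w₂ t x‖ ^ 2 := by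
  filter_upwards [hae] with t ht
  exact integral_congr_ae (ht.mono fun x hx => by
    show ‖w₁ t x‖ ^ 2 = ‖w₂ t x‖ ^ 2
    rw [hx])

end Torus

end Literature.Analysis.FluidPDE
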